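import Literature.Probability.Percolation.TrackExchangeGrowth
import HarnessLib

/-!
# Track exchange in a strip: the mirror image (sweeps from right to left)

Grimmett–Manolescu, *Bond percolation on isoradial graphs* (PTRF 159 (2014) 273–327 =
arXiv:1204.0505), §5.3: "`Σ_j` 'goes from left to right' when `β_j > β_{j-1}`. If
`β_j < β_{j-1}`, we construct `Σ_j` 'from right to left'." The files of this line implement the
left-to-right sweep only; the right-to-left one is its conjugate by the reflection `i ↦ -i` of
the strip, and this file provides the reflection:

* `TrackExchange.reflL : SV ≃ SV`, `(m, y) ↦ (-m, y)` (an involution), `reflPair` on pairs,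
  `reflW` on (configuration, walk) pairs;
* `TrackExchange.canonicalWeight_reflect` — the canonical weights of the strip with rhombus
  angles `Θ` are carried to those with angles `Θʳ i y = π - Θ (-1-i) y` (the rhombus
  `R_{i,y}` goes to `R_{-1-i,y}` with its primal diagonal of the other type); for
  `Θ = β - α` this is `β' - α'` with `α' i = -α (-1-i)`, `β' y = π - β y`, so bounded angles are
  preserved and the direction of a track exchange is reversed (`β'_j - β'_{j-1} = β_{j-1} - β_j`);
* transfer lemmas: `prodBernoulli_map_reflect` (laws), `Clean`, `IsWalk`, `colmax`
  (`colmax_map_reflL : colmax (W.map reflL) c = colmax W (-c)`), endpoints, parity, tent, and the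
  measurability of `reflW` for the discrete σ-algebra on walks.

## References

* G. R. Grimmett, I. Manolescu, PTRF 159 (2014) 273–327, arXiv:1204.0505, §5.3 (directions of
  `Σ_j`), §6.2 ("Without loss of generality we may suppose `β_k > ξ` […] the argument is valid
  regardless of the direction").
-/

noncomputable section

namespace Literature.Probability.Percolation

open LatticeModels StarTriangle Real MeasureTheory

namespace TrackExchange

/-! ### The reflection of the strip -/

/-- The reflection of labels `(m, y) ↦ (-m, y)`, `⋆ ↦ ⋆`. [cite: GrimmettManolescu2014Isoradial, §5.3] -/
def reflLFun : SV → SV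
  | some z => some (-z.1, z.2)
  | none => none

/-- The reflection is an involution. [folklore] -/
theorem reflLFun_reflLFun (z : SV) : reflLFun (reflLFun z) = z := by
  rcases z with _ | ⟨m, y⟩ <;> simp [reflLFun]

/-- **The reflection of the strip** as a permutation of the labels. [cite: GrimmettManolescu2014Isoradial, §5.3] -/
def reflL : SV ≃ SV := ⟨reflLFun, reflLFun, reflLFun_reflLFun, reflLFun_reflLFun⟩

/-- The reflection on a label. [folklore] -/
@[simp] theorem reflL_some (m y : ℤ) : reflL (some (m, y)) = some (-m, y) := rfl

/-- The reflection fixes `⋆`. [folklore] -/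
@[simp] theorem reflL_none : reflL none = none := rfl

/-- The reflection is an involution. [folklore] -/
@[simp] theorem reflL_reflL (z : SV) : reflL (reflL z) = z := reflLFun_reflLFun z

/-- The reflection is its own inverse. [folklore] -/
@[simp] theorem reflL_symm : reflL.symm = reflL := rfl

/-- The reflected rhombus angles: `R_{i,y} ↦ R_{-1-i,y}` with the complementary angle at the
mirrored corners. [cite: GrimmettManolescu2014Isoradial, §5.3] -/
def Θrefl (Θ : ℤ → ℤ → ℝ) : ℤ → ℤ → ℝ := fun i y => π - Θ (-1 - i) y

/-- Reflecting twice gives back the angles. [folklore] -/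
theorem Θrefl_Θrefl (Θ : ℤ → ℤ → ℝ) : Θrefl (Θrefl Θ) = Θ := by
  funext i y; simp [Θrefl]

/-- **The directed weights under reflection**: the weight of `(a, b)` for the reflected angles is
the weight of `(b̄, ā)` for the original ones. [cite: GrimmettManolescu2014Isoradial, §4.6] -/
theorem dirWeight_reflect (M : ℕ) (Θ : ℤ → ℤ → ℝ) (a b : ℤ × ℤ) :
    dirWeight M (Θrefl Θ) (some a) (some b) = dirWeight M Θ (some (-b.1, b.2)) (some (-a.1, a.2)) := by
  obtain ⟨a1, a2⟩ := a
  obtain ⟨b1, b2⟩ := b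
  simp only [dirWeight, Θrefl, Prod.mk.injEq]
  -- the case conditions correspond: even diagonal ↔ odd diagonal of the mirrored rhombus
  by_cases hA : (b1 = a1 + 1 ∧ b2 = a2 + 1) ∧ Even (a1 + a2) ∧ -(M : ℤ) ≤ a1 ∧ a1 < M
  · obtain ⟨⟨rfl, rfl⟩, ⟨r, hr⟩, h1, h2⟩ := hA
    rw [if_pos ⟨⟨rfl, rfl⟩, ⟨r, hr⟩, h1, h2⟩, if_neg, if_pos]
    · congr 1
      rw [sub_sub_cancel]
      congr 1 <;> ring
    · refine ⟨⟨by ring, by ring⟩, ?_, by omega, by omega⟩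
      rw [Int.not_even_iff_odd]; exact ⟨-r - 1 + a2, by omega⟩
    · rintro ⟨⟨-, h⟩, -⟩; omega
  · rw [if_neg hA]
    by_cases hB : (b1 = a1 + 1 ∧ b2 = a2 - 1) ∧ ¬ Even (a1 + (a2 - 1)) ∧ -(M : ℤ) ≤ a1 ∧ a1 < M
    · obtain ⟨⟨rfl, rfl⟩, hodd, h1, h2⟩ := hB
      have hev : Even (a1 + a2) := by
        rcases Int.even_or_odd (a1 + a2) with h | ⟨r, hr⟩
        · exact h
        · exact absurd ⟨r, by omega⟩ hodd
      obtain ⟨r, hr⟩ := hev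
      rw [if_pos ⟨⟨rfl, rfl⟩, hodd, h1, h2⟩, if_pos]
      · congr 1
        congr 1; ring
      · exact ⟨⟨by ring, by ring⟩, ⟨r - a1 - 1, by omega⟩, by omega, by omega⟩
    · rw [if_neg hB]
      rw [if_neg, if_neg]
      · rintro ⟨⟨h1, h2⟩, hodd, h3, h4⟩
        apply hA
        refine ⟨⟨by omega, by omega⟩, ?_, by omega, by omega⟩
        rcases Int.even_or_odd (a1 + a2) with h | ⟨r, hr⟩
        · exact h
        · exact absurd ⟨-r - 1 + a2, by omega⟩ hodd
      · rintro ⟨⟨h1, h2⟩, ⟨r, hr⟩, h3, h4⟩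
        apply hB
        refine ⟨⟨by omega, by omega⟩, ?_, by omega, by omega⟩
        rw [Int.not_even_iff_odd]; exact ⟨r + a1, by omega⟩

/-- **The canonical weights under reflection.** [cite: GrimmettManolescu2014Isoradial, §4.6] -/
theorem canonicalWeight_reflect (M : ℕ) (Θ : ℤ → ℤ → ℝ) (e : Sym2 SV) :
    canonicalWeight M (Θrefl Θ) e = canonicalWeight M Θ (Sym2.map reflL e) := by
  induction e using Sym2.ind with
  | _ u v =>
    rw [Sym2.map_mk, canonicalWeight_mk, canonicalWeight_mk]
    rcases u with _ | ⟨a1, a2⟩ <;> rcases v with _ | ⟨b1, b2⟩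
    · simp
    · simp
    · simp
    · rw [reflL_some, reflL_some, dirWeight_reflect, dirWeight_reflect, max_comm]

/-- The canonical weights of the reflected angles, composed with the reflection, are the original
ones. [folklore] -/
theorem canonicalWeight_reflect' (M : ℕ) (Θ : ℤ → ℤ → ℝ) (e : Sym2 SV) :
    canonicalWeight M (Θrefl Θ) (Sym2.map reflL e) = canonicalWeight M Θ e := by
  rw [canonicalWeight_reflect, Sym2.map_map]
  have : (reflL ∘ reflL : SV → SV) = id := by funext z; exact reflL_reflL z
  rw [this, Sym2.map_id, id]

/-! ### Configurations and walks under reflection -/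

/-- The reflection of a configuration. [folklore] -/
def reflCfg (ω : Set (Sym2 SV)) : Set (Sym2 SV) := sym2Equiv reflL '' ω

/-- Membership in the reflected configuration. [folklore] -/
theorem mem_reflCfg_iff {ω : Set (Sym2 SV)} {e : Sym2 SV} : e ∈ reflCfg ω ↔ Sym2.map reflL e ∈ ω := by
  unfold reflCfg
  rw [Set.mem_image_equiv, sym2Equiv_symm, reflL_symm, sym2Equiv_apply]

/-- Reflecting a configuration twice. [folklore] -/
@[simp] theorem reflCfg_reflCfg (ω : Set (Sym2 SV)) : reflCfg (reflCfg ω) = ω := by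
  ext e
  rw [mem_reflCfg_iff, mem_reflCfg_iff, Sym2.map_map]
  have : (reflL ∘ reflL : SV → SV) = id := by funext z; exact reflL_reflL z
  rw [this, Sym2.map_id, id]

/-- The reflection of configurations is measurable. [folklore] -/
theorem measurable_reflCfg : Measurable reflCfg := measurable_image_equiv _

/-- **Laws under reflection**: `P_{canonicalWeight M Θ}` is carried to
`P_{canonicalWeight M Θʳ}`. [cite: GrimmettManolescu2014Isoradial, §4.6] -/
theorem prodBernoulli_map_reflCfg (M : ℕ) (Θ : ℤ → ℤ → ℝ) :
    (prodBernoulli (canonicalWeight M Θ)).map reflCfg = prodBernoulli (canonicalWeight M (Θrefl Θ)) :=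
  prodBernoulli_map_image_of_comp_eq _ _ (sym2Equiv reflL) fun e => by
    rw [sym2Equiv_apply]; exact canonicalWeight_reflect' M Θ e

/-- The reflection of a (configuration, walk) pair. [folklore] -/
def reflW (x : ExchangeData.WState) : ExchangeData.WState := (reflCfg x.1, x.2.map reflL)

/-- Reflecting a pair twice. [folklore] -/
@[simp] theorem reflW_reflW (x : ExchangeData.WState) : reflW (reflW x) = x := by
  unfold reflW
  rw [reflCfg_reflCfg, List.map_map]
  have : (reflL ∘ reflL : SV → SV) = id := by funext z; exact reflL_reflL z
  rw [this, List.map_id]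

/-- A reflected walk is open in the reflected configuration. [folklore] -/
theorem isWalk_reflW {x : ExchangeData.WState} (h : IsWalk x.1 x.2) : IsWalk (reflW x).1 (reflW x).2 := by
  unfold reflW reflCfg
  have hc : (⇑(sym2Equiv reflL) : Sym2 SV → Sym2 SV) = Sym2.map reflL := funext (sym2Equiv_apply reflL)
  rw [hc]
  exact isWalk_map reflL h

/-- Clean configurations reflect to clean configurations. [folklore] -/
theorem clean_reflCfg {M : ℕ} {Θ : ℤ → ℤ → ℝ} {ω : Set (Sym2 SV)} (h : Clean (canonicalWeight M Θ) ω) :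
    Clean (canonicalWeight M (Θrefl Θ)) (reflCfg ω) := by
  intro e he
  rw [mem_reflCfg_iff] at he
  rw [canonicalWeight_reflect]
  exact h _ he

/-- Labels of a reflected walk. [folklore] -/
theorem mem_map_reflL_iff {W : List SV} {m y : ℤ} : some (m, y) ∈ W.map reflL ↔ some (-m, y) ∈ W := by
  rw [List.mem_map]
  constructor
  · rintro ⟨z, hz, hzm⟩
    rcases z with _ | ⟨m', y'⟩
    · simp at hzm
    · simp only [reflL_some, Option.some.injEq, Prod.mk.injEq] at hzm
      obtain ⟨rfl, rfl⟩ := hzm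
      simpa using hz
  · intro h; exact ⟨some (-m, y), h, by simp⟩

/-- `⋆` is on a reflected walk iff it is on the walk. [folklore] -/
theorem none_mem_map_reflL_iff {W : List SV} : none ∈ W.map reflL ↔ none ∈ W := by
  rw [List.mem_map]
  constructor
  · rintro ⟨z, hz, hzm⟩
    rcases z with _ | ⟨m', y'⟩
    · exact hz
    · simp at hzm
  · intro h; exact ⟨none, h, rfl⟩

/-- The heights of a reflected walk in column `c` are those of the walk in column `-c`. [folklore] -/
theorem colmax_map_reflL (W : List SV) (c : ℤ) : colmax (W.map reflL) c = colmax W (-c) := by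
  apply le_antisymm
  · refine colmax_le fun y hy => le_colmax ?_
    rw [mem_map_reflL_iff] at hy; exact hy
  · refine colmax_le fun y hy => le_colmax ?_
    rw [mem_map_reflL_iff]; exact hy

/-- The first vertex of a reflected walk. [folklore] -/
theorem head?_map_reflL (W : List SV) : (W.map reflL).head? = W.head?.map reflL := List.head?_map

/-- The last vertex of a reflected walk. [folklore] -/
theorem getLast?_map_reflL (W : List SV) : (W.map reflL).getLast? = W.getLast?.map reflL := List.getLast?_map

end TrackExchange

end Literature.Probability.Percolation
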